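import Literature.MathematicalPhysics.QuantumFieldTheory.Federbush1986.NonAbelianDualityTopStep

/-!
# `Federbush1986.PlaquetteStokes` — Green's theorem on a lattice plaquette: the circulation of the line integrals of a `C¹`
# potential around a plaquette of side `ℓ` equals the face integral of its (abelian) curl — binder-free infrastructure for
# [Federbush1987PhaseCellVI] Theorem 2 p. 20 and [Federbush1986PhaseCellI] §4 p. 329; theorems + two plumbing defs

statement-level skeleton of published theorems with citation tags; proofs where landed; nothing here is a claim about the Yang–Mills mass gap

CITATION HEADER.  P. Federbush, *A phase cell approach to Yang–Mills theory. VI. Non-abelian lattice-continuum duality*,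
Ann. Inst. H. Poincaré (Physique théorique) **47** (1987) 17–23 [Federbush1987PhaseCellVI]: (7) p. 19 «g₀(e, A_μ) … the group
element obtained by exponentiating ∫_e A⃗·d⃗s … along a straight line joining the vertices of e»; (10) p. 20 «S^r_0 =
¼Σ_p|g_∂p|²»; Theorem 2 p. 20 «the corresponding lattice actions, S^r_0, converge to the continuum action [½∫(dA + A∧A)²,
p. 18] as r → ∞».  P. Federbush, *… I*, Commun. Math. Phys. **107** (1986) 319–329 [Federbush1986PhaseCellI], §4 p. 329.
Unit `lit-balaban-r17` gen 3 (fold owner of the Federbush block); SKELETON rows **F6.Thm2**, **F6.Eq7**, **F1.Sect§4** of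
`run/shared/lean/pub/lit-balaban/lit-balaban-r17/SKELETON-r17.md`.  Companion of `LatticeRiemannSums` (p249266): together they
reduce the ABELIAN part of «lattice action → continuum action» to dominated convergence; the non-abelian part (commutator
term, BCH) is the subject of typing note T-F6-2 (HOME/STATUS 2026-08-21T04:53Z) and is not touched here.

THE MATHEMATICS.  For the plaquette `p` with lower vertex `x`, side `ℓ`, in the `(μ, ν)` coordinate plane, and the edge
order of `plaqHol` (`e₁ = (x, μ)`, `e₂ = (x + ℓu_μ, ν)`, `e₃ = (x + ℓu_ν, μ)` reversed, `e₄ = (x, ν)` reversed), the line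
integrals `λ(e) = ∫₀^ℓ A_{dir e}(src e + t u_{dir e}) dt` of a `C¹` potential satisfy GREEN'S IDENTITY
`λ(e₁) + λ(e₂) − λ(e₃) − λ(e₄) = ∫₀^ℓ∫₀^ℓ (∂_μA_ν − ∂_νA_μ)(x + s u_μ + t u_ν) dt ds` — Mathlib's divergence theorem on a
rectangle (`MeasureTheory.integral2_divergence_prod_of_hasFDerivAt`) for `f(s,t) = A_ν(x + s u_μ + t u_ν)`,
`g(s,t) = −A_μ(x + s u_μ + t u_ν)`.  Hence `λ₁ + λ₂ − λ₃ − λ₄ = ℓ²·(face average of the abelian curl)`, the input of the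
lattice Riemann sums.

WHAT THIS MODULE PROVES (theorems + the two plumbing defs `planeMap`/`planeDeriv`; no `Prop` definition, no named fact;
axioms standard).  `loop_eq_integral_curl` (general base point, side and value space; no completeness needed), `Edge.src_shift` (`src (b + 1_μ, ·) = src (b, ·) + ℓ_r u_μ`), and **`BlockSpinSystem.logData_plaquette`** — the
identity for the four `logData` (7) of a level-`r` plaquette `⟨b, μ, ν⟩`.
-/

namespace Literature.MathematicalPhysics.QuantumFieldTheory.Federbush1986

noncomputable section

open MeasureTheory Set intervalIntegral
open scoped Topology Interval

namespace PlaquetteStokes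

variable {W : Type*} [NormedAddCommGroup W] [NormedSpace ℝ W]

/-- The affine parametrisation `(s, t) ↦ x + s u_μ + t u_ν` of the plaquette plane. [cite: Federbush1987PhaseCellVI, (7)
p. 19, (10) p. 20] -/
def planeMap (x : E4) (μ ν : Fin 4) (z : ℝ × ℝ) : E4 := x + (z.1 • unitVec μ + z.2 • unitVec ν)

/-- Its (constant) derivative `(σ, τ) ↦ σ u_μ + τ u_ν`. [cite: Federbush1987PhaseCellVI, (7) p. 19] -/
def planeDeriv (μ ν : Fin 4) : ℝ × ℝ →L[ℝ] E4 :=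
  (ContinuousLinearMap.fst ℝ ℝ ℝ).smulRight (unitVec μ) + (ContinuousLinearMap.snd ℝ ℝ ℝ).smulRight (unitVec ν)

/-- The plane map has derivative `planeDeriv`. [cite: Federbush1987PhaseCellVI, (7) p. 19] -/
theorem hasFDerivAt_planeMap (x : E4) (μ ν : Fin 4) (z : ℝ × ℝ) :
    HasFDerivAt (planeMap x μ ν) (planeDeriv μ ν) z := by
  have h := (((ContinuousLinearMap.fst ℝ ℝ ℝ).hasFDerivAt (x := z)).smul_const (unitVec μ)).add
    (((ContinuousLinearMap.snd ℝ ℝ ℝ).hasFDerivAt (x := z)).smul_const (unitVec ν))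
  exact h.const_add x

/-- The plane map is continuous. [cite: Federbush1987PhaseCellVI, (7) p. 19] -/
theorem continuous_planeMap (x : E4) (μ ν : Fin 4) : Continuous (planeMap x μ ν) :=
  continuous_const.add ((continuous_fst.smul continuous_const).add (continuous_snd.smul continuous_const))

/-- `planeDeriv (σ, τ) = σ u_μ + τ u_ν`. [cite: Federbush1987PhaseCellVI, (7) p. 19] -/
@[simp] theorem planeDeriv_apply (μ ν : Fin 4) (z : ℝ × ℝ) :
    planeDeriv μ ν z = z.1 • unitVec μ + z.2 • unitVec ν := rfl

/-- **Green's identity on a plaquette.**  For a `C¹` potential `A : ℝ⁴ → (Fin 4 → W)`, the circulation of its edge line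
integrals around the square of side `ℓ` at `x` in the `(μ, ν)`-plane (edge order of `plaqHol`) equals the face integral of
`∂_μA_ν − ∂_νA_μ`. [cite: Federbush1987PhaseCellVI, (7) p. 19, (10) and Theorem 2 p. 20; Federbush1986PhaseCellI, §4 p. 329] -/
theorem loop_eq_integral_curl (A : E4 → Fin 4 → W) (hA : ContDiff ℝ 1 A) (x : E4) (ℓ : ℝ) (μ ν : Fin 4) :
    (∫ s in (0 : ℝ)..ℓ, A (x + s • unitVec μ) μ) + (∫ t in (0 : ℝ)..ℓ, A (x + ℓ • unitVec μ + t • unitVec ν) ν)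
      - (∫ s in (0 : ℝ)..ℓ, A (x + ℓ • unitVec ν + s • unitVec μ) μ) - (∫ t in (0 : ℝ)..ℓ, A (x + t • unitVec ν) ν)
    = ∫ s in (0 : ℝ)..ℓ, ∫ t in (0 : ℝ)..ℓ,
        (fderiv ℝ (fun y => A y ν) (x + s • unitVec μ + t • unitVec ν) (unitVec μ)
          - fderiv ℝ (fun y => A y μ) (x + s • unitVec μ + t • unitVec ν) (unitVec ν)) := by
  have hAc : ∀ i, ContDiff ℝ 1 (fun y => A y i) := fun i => contDiff_pi.1 hA i
  set P := planeMap x μ ν with hP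
  set f : ℝ × ℝ → W := fun z => A (P z) ν with hf
  set g : ℝ × ℝ → W := fun z => -A (P z) μ with hg
  set f' : ℝ × ℝ → ℝ × ℝ →L[ℝ] W := fun z => (fderiv ℝ (fun y => A y ν) (P z)).comp (planeDeriv μ ν) with hf'
  set g' : ℝ × ℝ → ℝ × ℝ →L[ℝ] W := fun z => -((fderiv ℝ (fun y => A y μ) (P z)).comp (planeDeriv μ ν)) with hg'
  have hPc : Continuous P := continuous_planeMap x μ ν
  have Hcf : ContinuousOn f ([[(0 : ℝ), ℓ]] ×ˢ [[(0 : ℝ), ℓ]]) := ((hAc ν).continuous.comp hPc).continuousOn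
  have Hcg : ContinuousOn g ([[(0 : ℝ), ℓ]] ×ˢ [[(0 : ℝ), ℓ]]) := ((hAc μ).continuous.comp hPc).neg.continuousOn
  have Hdf : ∀ z ∈ Ioo (min 0 ℓ) (max 0 ℓ) ×ˢ Ioo (min 0 ℓ) (max 0 ℓ), HasFDerivAt f (f' z) z := by
    intro z _
    exact (((hAc ν).differentiable one_ne_zero) (P z)).hasFDerivAt.comp z (hasFDerivAt_planeMap x μ ν z)
  have Hdg : ∀ z ∈ Ioo (min 0 ℓ) (max 0 ℓ) ×ˢ Ioo (min 0 ℓ) (max 0 ℓ), HasFDerivAt g (g' z) z := by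
    intro z _
    exact ((((hAc μ).differentiable one_ne_zero) (P z)).hasFDerivAt.comp z (hasFDerivAt_planeMap x μ ν z)).neg
  have hdiv : ∀ z, f' z (1, 0) + g' z (0, 1) =
      fderiv ℝ (fun y => A y ν) (P z) (unitVec μ) - fderiv ℝ (fun y => A y μ) (P z) (unitVec ν) := by
    intro z
    simp only [hf', hg', ContinuousLinearMap.comp_apply, _root_.neg_apply, planeDeriv_apply,
      one_smul, zero_smul, add_zero, zero_add, sub_eq_add_neg]
  have hcont : Continuous fun z : ℝ × ℝ => f' z (1, 0) + g' z (0, 1) := by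
    simp_rw [hdiv]
    refine Continuous.sub ?_ ?_
    · exact (((hAc ν).continuous_fderiv one_ne_zero).comp hPc).clm_apply continuous_const
    · exact (((hAc μ).continuous_fderiv one_ne_zero).comp hPc).clm_apply continuous_const
  have Hi : IntegrableOn (fun z => f' z (1, 0) + g' z (0, 1)) ([[(0 : ℝ), ℓ]] ×ˢ [[(0 : ℝ), ℓ]]) :=
    hcont.continuousOn.integrableOn_compact (isCompact_uIcc.prod isCompact_uIcc)
  have key := MeasureTheory.integral2_divergence_prod_of_hasFDerivAt f g f' g' 0 0 ℓ ℓ Hcf Hcg Hdf Hdg Hi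
  -- identify the two sides
  have hL : (∫ s in (0 : ℝ)..ℓ, ∫ t in (0 : ℝ)..ℓ, f' (s, t) (1, 0) + g' (s, t) (0, 1)) =
      ∫ s in (0 : ℝ)..ℓ, ∫ t in (0 : ℝ)..ℓ,
        (fderiv ℝ (fun y => A y ν) (x + s • unitVec μ + t • unitVec ν) (unitVec μ)
          - fderiv ℝ (fun y => A y μ) (x + s • unitVec μ + t • unitVec ν) (unitVec ν)) := by
    simp_rw [hdiv, hP, planeMap, add_assoc]
  have h1 : (∫ s in (0 : ℝ)..ℓ, g (s, ℓ)) = -∫ s in (0 : ℝ)..ℓ, A (x + ℓ • unitVec ν + s • unitVec μ) μ := by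
    rw [← intervalIntegral.integral_neg]
    refine intervalIntegral.integral_congr fun s _ => ?_
    simp only [hg, hP, planeMap, add_assoc, add_comm (s • unitVec μ)]
  have h2 : (∫ s in (0 : ℝ)..ℓ, g (s, 0)) = -∫ s in (0 : ℝ)..ℓ, A (x + s • unitVec μ) μ := by
    rw [← intervalIntegral.integral_neg]
    refine intervalIntegral.integral_congr fun s _ => ?_
    simp only [hg, hP, planeMap, zero_smul, add_zero]
  have h3 : (∫ t in (0 : ℝ)..ℓ, f (ℓ, t)) = ∫ t in (0 : ℝ)..ℓ, A (x + ℓ • unitVec μ + t • unitVec ν) ν := by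
    refine intervalIntegral.integral_congr fun t _ => ?_
    simp only [hf, hP, planeMap, add_assoc]
  have h4 : (∫ t in (0 : ℝ)..ℓ, f (0, t)) = ∫ t in (0 : ℝ)..ℓ, A (x + t • unitVec ν) ν := by
    refine intervalIntegral.integral_congr fun t _ => ?_
    simp only [hf, hP, planeMap, zero_smul, zero_add]
  rw [hL, h1, h2, h3, h4] at key
  rw [key]
  abel

end PlaquetteStokes

/-! ## The identity for the four `logData` (7) of a level-`r` plaquette -/

/-- `src (b + 1_μ, ·) = src (b, ·) + ℓ_r u_μ`. [cite: Federbush1986PhaseCellI, §1 p. 321; Federbush1987PhaseCellVI, (7)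
p. 19] -/
theorem Edge.src_shift {r : ℕ} (b : Fin 4 → ℤ) (μ d : Fin 4) :
    (⟨b + Pi.single μ 1, d⟩ : Edge r).src = (⟨b, d⟩ : Edge r).src + latLen r • unitVec μ := by
  ext i
  by_cases h : i = μ
  · subst h; simp [Edge.src, mkPt, unitVec, mul_add]
  · simp [Edge.src, mkPt, unitVec, h, mul_add]

namespace BlockSpinSystem

variable (S : BlockSpinSystem)

/-- **Green's identity for the logarithms (7) of a plaquette.**  For a `C¹` potential and the plaquette `⟨b, μ, ν⟩` of
`ℒ^r` (edge order of `plaqHol`: `(b, μ)`, `(b + 1_μ, ν)`, `(b + 1_ν, μ)` reversed, `(b, ν)` reversed),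
`λ(e₁) + λ(e₂) − λ(e₃) − λ(e₄) = ∫₀^{ℓ_r}∫₀^{ℓ_r} (∂_μA_ν − ∂_νA_μ)(src + s u_μ + t u_ν) dt ds` — the abelian part of the
plaquette variable entering (10). [cite: Federbush1987PhaseCellVI, (7) p. 19, (10) and Theorem 2 p. 20] -/
theorem logData_plaquette (A : S.Potential) (hA : ContDiff ℝ 1 A) (r : ℕ) (b : Fin 4 → ℤ) (μ ν : Fin 4) :
    S.logData A r ⟨b, μ⟩ + S.logData A r ⟨b + Pi.single μ 1, ν⟩
      - S.logData A r ⟨b + Pi.single ν 1, μ⟩ - S.logData A r ⟨b, ν⟩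
    = ∫ s in (0 : ℝ)..latLen r, ∫ t in (0 : ℝ)..latLen r,
        (fderiv ℝ (fun y => A y ν) ((⟨b, μ⟩ : Edge r).src + s • unitVec μ + t • unitVec ν) (unitVec μ)
          - fderiv ℝ (fun y => A y μ) ((⟨b, μ⟩ : Edge r).src + s • unitVec μ + t • unitVec ν) (unitVec ν)) := by
  have hsrc : ((⟨b, ν⟩ : Edge r).src) = (⟨b, μ⟩ : Edge r).src := rfl
  simp only [logData, Edge.src_shift, hsrc]
  exact PlaquetteStokes.loop_eq_integral_curl A hA _ (latLen r) μ ν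

end BlockSpinSystem

end

end Literature.MathematicalPhysics.QuantumFieldTheory.Federbush1986
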